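import Summits.BirchSwinnertonDyer.BirchSwinnertonDyer.Theorems.PrintCf2RamifiedOffTYZTheoremAReciprocity
import HarnessLib

/-!
# Route `PrintCf2`, crux stmt-BirchSwinnertonDyer-20509 `RamifiedOffTYZOfFacts`, THEOREM A's target (T3), LOCAL HALF: the Artin symbol of
# `(γ)`, `γ = u·l^ε·β₀²` (`u = ±1`, `l ≡ 1 (mod 8)`), FIXES `s(τ₀)` — the `χ₈`-computation of g29's order-two arithmetic
# (cell `bsd-print-cf2`, LEAD cruxlead-20509 g32, line `offtyz-v7`, lineage cycle 33; `def`-free; conditional on Cox's display like (R1))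

HONEST FRAMING (`--supports stmt-BirchSwinnertonDyer-20509`; theorems only, no `sorry`, no new named fact).  BSD is not proved by any of this; no
class is closed by this file; item 23431 (C⁺) and crux 20509 stay OPEN.  Target (T3) of THEOREM A's road (memo
`Cruxes/RamifiedOffTYZOfFacts/Lines/offtyz_v7_TheoremARoad.md` §3c; `TheoremATargets.orbitProd_sq_of_targets`, p812073) reads «`g^{g(n)}` fixes `s₀` for every
`g ∈ Gal(K^{(32)}/L₁)`»; ideal-theoretically `g^{g(n)} = ((K^{(32)}|K)/(γ))` with `(γ) = 𝔠²·(l)^ε`, `[𝔠] ∈ Cl[2] = ⟨[𝔭_l]⟩`, i.e. `γ = u·l^ε·β₀²`,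
`u = ±1`.  THIS FILE proves the LOCAL half: such a `γ` acts trivially on `y = e⁻¹ s(τ₀)` (via `TheoremAReciprocity.artinSymbol_principal_apply_sqrtX_eq_self`,
p811633): writing `β₀ = A₀ + B₀θ` (`θ² = −bθ − ac`, `32 ∣ a`), `γ = A + Bθ` with `A = u l^ε (A₀² − acB₀²)`, `B = u l^ε (2A₀B₀ − bB₀²)`, and for any
`n′` with `n′N(γ) ≡ 1 (mod 32)`: `χ₈(n′A) = χ₈(A − bB) = χ₈(u)·χ₈(l)^ε·χ₈((A₀ − bB₀)²) = 1`.  The GLOBAL half («every `g^{g(n)}` is such an Artin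
symbol»: Artin surjectivity, the genus character, the ambiguous classes of `ℚ(√−lq)`) is NOT here.

* `sq_mul_coords` — `u l^ε (A₀ + B₀θ)² = A + Bθ` in any commutative ring with `θ² = −bθ − ac`;
* `chi8_eq_one_of_sq_mul` — the `χ₈`-computation: `χ₈(n′A) = 1`;
* ★ `artinSymbol_sq_mul_apply_sqrtX_eq_self` — **`((K^{(32)}|K)/(u l^ε β₀²)) y = y`** for `e y = s(τ₀)` (granted Cox's display; `(u l^ε β₀²)` prime to `32`).

References: [cite: Cox2013, Thm. 15.17]; [cite: Savitt2025, Thm. 1]; LEAD g29 memo `Lines/offtyz_v7_ExactDescent.md` §2c; tree p811633.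
-/

noncomputable section

open UpperHalfPlane hiding I
open NumberField IsDedekindDomain Complex
open scoped MatrixGroups

namespace Summit.BirchSwinnertonDyer.PrintCf2.TheoremAOrderTwoLocal

open Literature.NumberTheory.NumberFields Literature.NumberTheory.GaloisRepresentations
open Literature.NumberTheory.EllipticCurves (heegnerTau)
open Literature.NumberTheory.EllipticCurves.ModularForms
open Literature.NumberTheory.ComplexMultiplication.Cox2013
open Summit.BirchSwinnertonDyer.PrintCf2.TheoremAReciprocity

/-! ## §1 Coordinates of `u l^ε β₀²` on the basis `(1, θ)` -/

/-- `u l^ε (A₀ + B₀θ)² = A + Bθ` with `A = u l^ε (A₀² − acB₀²)`, `B = u l^ε (2A₀B₀ − bB₀²)`, whenever `θ² = −bθ − ac`. [folklore] -/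
theorem sq_mul_coords {S : Type*} [CommRing S] (θ : S) (a b c A₀ B₀ u w : ℤ) (hθ : θ ^ 2 + b * θ + a * c = 0) :
    (u : S) * w * ((A₀ : S) + B₀ * θ) ^ 2 =
      ((u * w * (A₀ ^ 2 - a * c * B₀ ^ 2) : ℤ) : S) + ((u * w * (2 * A₀ * B₀ - b * B₀ ^ 2) : ℤ) : S) * θ := by
  have hθ2 : θ ^ 2 = -(b : S) * θ - a * c := by linear_combination hθ
  push_cast
  linear_combination ((u : S) * w * (B₀ : S) ^ 2) * hθ

/-! ## §2 The `χ₈`-computation -/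

/-- For `u = ±1`, `χ₈(u) = 1` (`(2/−1) = (2/7) = 1`). [folklore] -/
theorem chi8_unit {u : ℤ} (hu : u = 1 ∨ u = -1) : ZMod.χ₈ ((u : ℤ) : ZMod 8) = 1 := by
  rcases hu with rfl | rfl <;> decide

/-- `χ₈` of an odd square is `1`. [folklore] -/
theorem chi8_sq_of_odd {m : ℤ} (hm : Odd m) : ZMod.χ₈ ((m ^ 2 : ℤ) : ZMod 8) = 1 := by
  rw [Int.cast_pow, map_pow]
  rcases chi8_eq_one_or_neg_one_of_odd hm with h | h <;> rw [h] <;> norm_num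

/-- For odd `N`, `N⁸ ≡ 1 (mod 32)` (the exponent of `(ℤ/32)ˣ` is `8`); so `n′ = N⁷` inverts `N` modulo `32`. [folklore] -/
theorem pow_eight_eq_one_of_odd {N : ℤ} (hN : Odd N) : ((N ^ 7 * N : ℤ) : ZMod 32) = 1 := by
  obtain ⟨k, rfl⟩ := hN
  have key : ∀ x : ZMod 32, (2 * x + 1) ^ 7 * (2 * x + 1) = 1 := by decide
  have := key (k : ZMod 32)
  push_cast
  exact this

/-- ★ **The `χ₈`-data of `γ = u l^ε β₀²` is trivial.**  With `32 ∣ a`, `u = ±1`, `l ≡ 1 (mod 8)`, `N(β₀) = A₀² − bA₀B₀ + acB₀²` odd,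
`A = u l^ε (A₀² − acB₀²)`, `B = u l^ε (2A₀B₀ − bB₀²)` and `n′(A² − bAB + acB²) ≡ 1 (mod 32)`: `χ₈(n′A) = 1`. [folklore] -/
theorem chi8_eq_one_of_sq_mul {a b c A₀ B₀ u l n' A B : ℤ} {ε : ℕ} (h32 : (32 : ℤ) ∣ a) (hu : u = 1 ∨ u = -1) (hl : l % 8 = 1)
    (hodd : Odd (A₀ ^ 2 - b * A₀ * B₀ + a * c * B₀ ^ 2))
    (hA : A = u * l ^ ε * (A₀ ^ 2 - a * c * B₀ ^ 2)) (hB : B = u * l ^ ε * (2 * A₀ * B₀ - b * B₀ ^ 2))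
    (hn' : ((n' * (A ^ 2 - b * A * B + a * c * B ^ 2) : ℤ) : ZMod 32) = 1) :
    ZMod.χ₈ ((n' * A : ℤ) : ZMod 8) = 1 := by
  obtain ⟨a', rfl⟩ := h32
  -- `A₀ − bB₀` is odd
  have hA₀' : Odd (A₀ - b * B₀) := by
    have hsplit : A₀ * (A₀ - b * B₀) = (A₀ ^ 2 - b * A₀ * B₀ + 32 * a' * c * B₀ ^ 2) - 2 * (16 * a' * c * B₀ ^ 2) := by ring
    have h2 : Odd (A₀ * (A₀ - b * B₀)) := by
      rw [hsplit]; exact Int.odd_sub.mpr ⟨fun _ => even_two_mul _, fun _ => hodd⟩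
    exact (Int.odd_mul.mp h2).2
  -- reduce `hn'` to `ZMod 8`
  have hn8 : ((n' * (A ^ 2 - b * A * B + 32 * a' * c * B ^ 2) : ℤ) : ZMod 8) = 1 := by
    have := congrArg (ZMod.castHom (show 8 ∣ 32 by norm_num) (ZMod 8)) hn'
    simpa only [map_intCast, map_one] using this
  have hl8 : ((l : ℤ) : ZMod 8) = 1 := by
    have : ((l : ℤ) : ZMod 8) = ((l % 8 : ℤ) : ZMod 8) := (ZMod.intCast_mod l 8).symm
    rw [this, hl]; rfl
  have h32' : (32 : ZMod 8) = 0 := by decide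
  -- `n′ A (A − bB) ≡ 1 (mod 8)`
  have hprod : (((n' * A) * (A - b * B) : ℤ) : ZMod 8) = 1 := by
    rw [← hn8]; push_cast; rw [h32']; ring
  -- `A − bB ≡ u l^ε (A₀ − bB₀)² (mod 8)`
  have hdiff : (((A - b * B) : ℤ) : ZMod 8) = (((u * l ^ ε * (A₀ - b * B₀) ^ 2) : ℤ) : ZMod 8) := by
    rw [hA, hB]; push_cast; rw [h32']; ring
  have hχdiff : ZMod.χ₈ (((A - b * B : ℤ) : ZMod 8)) = 1 := by
    rw [hdiff, Int.cast_mul, Int.cast_mul, map_mul, map_mul, chi8_unit hu, Int.cast_pow, map_pow, hl8, map_one, one_pow, one_mul,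
      one_mul, chi8_sq_of_odd hA₀']
  have hmul := congrArg ZMod.χ₈ hprod
  rw [Int.cast_mul, map_mul, map_one, hχdiff, mul_one] at hmul
  exact hmul

/-! ## §3 The Artin symbol of `(u l^ε β₀²)` fixes `y = e⁻¹ s(τ₀)` -/

/-- ★ **`((K^{(32)}|K)/(u·l^ε·β₀²)) y = y`** for `e y = s(τ₀)`: the local half of target (T3), granted Cox's display `h`.
Hypotheses as in `TheoremAReciprocity.artinSymbol_principal_apply_sqrtX` for the element `γ = u l^ε β₀² ∈ 𝓞 K` (`(γ)` prime to `32`), plus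
`θ² + bθ + ac = 0`, `β₀ = A₀ + B₀θ` with `N(β₀)` odd, `u = ±1`, `l ≡ 1 (mod 8)`. [cite: Cox2013, Thm. 15.17] [cite: Savitt2025, Thm. 1] -/
theorem artinSymbol_sq_mul_apply_sqrtX_eq_self (h : cox2013_shimuraReciprocity_rayClassField)
    (K : Type) [Field K] [NumberField K] (ι : K →+* ℂ)
    (hK : Literature.NumberTheory.EllipticCurves.IsImaginaryQuadratic K)
    (a b c : ℤ) (ha : 0 < a) (hD : b ^ 2 - 4 * a * c < 0) (hprim : Int.gcd (Int.gcd a b) c = 1) (h32 : (32 : ℤ) ∣ a)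
    (θ : 𝓞 K) (hθ : ι (θ : K) = (a : ℂ) * ((heegnerTau (a, b, c) : ℍ) : ℂ)) (hθrel : (θ : K) ^ 2 + b * (θ : K) + a * c = 0)
    (hgen : ∀ z : 𝓞 K, ∃ A B : ℤ, (z : K) = A + B * (θ : K))
    (e : rayClassField K (Ideal.span {((32 : ℕ) : 𝓞 K)}) →+* ℂ)
    (he : ∀ k : K, e (algebraMap K (rayClassField K (Ideal.span {((32 : ℕ) : 𝓞 K)})) k) = ι k)
    (β₀ : 𝓞 K) (A₀ B₀ : ℤ) (hβ₀ : (β₀ : K) = A₀ + B₀ * (θ : K)) (hodd : Odd (A₀ ^ 2 - b * A₀ * B₀ + a * c * B₀ ^ 2))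
    (u l : ℤ) (hu : u = 1 ∨ u = -1) (hl : l % 8 = 1) (ε : ℕ)
    (hγ : (((u * l ^ ε : ℤ) : 𝓞 K) * β₀ ^ 2 : K) ≠ 0)
    (hγm : toPrincipalIdeal (𝓞 K) K (Units.mk0 ((((u * l ^ ε : ℤ) : 𝓞 K) * β₀ ^ 2 : 𝓞 K) : K) hγ) ∈ idealsPrimeTo (Ideal.span {((32 : ℕ) : 𝓞 K)}))
    (y : rayClassField K (Ideal.span {((32 : ℕ) : 𝓞 K)})) (hy : e y = etaQuotient 32 rS (heegnerTau (a, b, c))) :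
    artinHom (galFrob K (rayClassField K (Ideal.span {((32 : ℕ) : 𝓞 K)})))
        (toPrincipalIdeal (𝓞 K) K (Units.mk0 ((((u * l ^ ε : ℤ) : 𝓞 K) * β₀ ^ 2 : 𝓞 K) : K) hγ)) y = y := by
  -- coordinates of `γ`
  have hAB : ((((u * l ^ ε : ℤ) : 𝓞 K) * β₀ ^ 2 : 𝓞 K) : K) =
      ((u * l ^ ε * (A₀ ^ 2 - a * c * B₀ ^ 2) : ℤ) : K) + ((u * l ^ ε * (2 * A₀ * B₀ - b * B₀ ^ 2) : ℤ) : K) * (θ : K) := by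
    have hcast : ∀ z : ℤ, (((z : ℤ) : 𝓞 K) : K) = (z : K) := fun z => by simp
    have e1 : ((((u * l ^ ε : ℤ) : 𝓞 K) * β₀ ^ 2 : 𝓞 K) : K) = (u : K) * (l ^ ε : ℤ) * ((A₀ : K) + B₀ * (θ : K)) ^ 2 := by
      rw [← hβ₀]; push_cast; simp only [hcast]
    rw [e1, sq_mul_coords (θ : K) a b c A₀ B₀ u (l ^ ε) hθrel]
  -- `N(γ) = A² − bAB + acB²` is odd, so `n′ := N(γ)⁷` inverts it modulo `32`
  set A : ℤ := u * l ^ ε * (A₀ ^ 2 - a * c * B₀ ^ 2) with hAdef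
  set B : ℤ := u * l ^ ε * (2 * A₀ * B₀ - b * B₀ ^ 2) with hBdef
  have hNodd : Odd (A ^ 2 - b * A * B + a * c * B ^ 2) := by
    obtain ⟨a', ha'⟩ := h32
    have hA₀ : Odd A₀ := by
      have hsplit : A₀ * (A₀ - b * B₀) = (A₀ ^ 2 - b * A₀ * B₀ + a * c * B₀ ^ 2) - 2 * (16 * a' * c * B₀ ^ 2) := by rw [ha']; ring
      have h2 : Odd (A₀ * (A₀ - b * B₀)) := by
        rw [hsplit]; exact Int.odd_sub.mpr ⟨fun _ => even_two_mul _, fun _ => hodd⟩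
      exact (Int.odd_mul.mp h2).1
    have hA₀' : Odd (A₀ - b * B₀) := by
      have hsplit : A₀ * (A₀ - b * B₀) = (A₀ ^ 2 - b * A₀ * B₀ + a * c * B₀ ^ 2) - 2 * (16 * a' * c * B₀ ^ 2) := by rw [ha']; ring
      have h2 : Odd (A₀ * (A₀ - b * B₀)) := by
        rw [hsplit]; exact Int.odd_sub.mpr ⟨fun _ => even_two_mul _, fun _ => hodd⟩
      exact (Int.odd_mul.mp h2).2
    have hul : Odd (u * l ^ ε) := by
      refine Int.odd_mul.mpr ⟨by rcases hu with rfl | rfl <;> decide, Odd.pow ?_⟩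
      exact Int.odd_iff.mpr (by omega)
    have hAo : Odd A := by
      rw [hAdef]
      refine Int.odd_mul.mpr ⟨hul, ?_⟩
      have : A₀ ^ 2 - a * c * B₀ ^ 2 = A₀ ^ 2 - 2 * (16 * a' * c * B₀ ^ 2) := by rw [ha']; ring
      rw [this]; exact Int.odd_sub.mpr ⟨fun _ => even_two_mul _, fun _ => hA₀.pow⟩
    have hAB' : Odd (A - b * B) := by
      have : A - b * B = u * l ^ ε * (A₀ - b * B₀) ^ 2 - 2 * (u * l ^ ε * (16 * a' * c * B₀ ^ 2)) := by rw [hAdef, hBdef, ha']; ring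
      rw [this]; exact Int.odd_sub.mpr ⟨fun _ => even_two_mul _, fun _ => Int.odd_mul.mpr ⟨hul, hA₀'.pow⟩⟩
    have : A ^ 2 - b * A * B + a * c * B ^ 2 = A * (A - b * B) + 2 * (16 * a' * c * B ^ 2) := by rw [ha']; ring
    rw [this]
    exact Int.odd_add.mpr ⟨fun _ => even_two_mul _, fun _ => Int.odd_mul.mpr ⟨hAo, hAB'⟩⟩
  set n' : ℤ := (A ^ 2 - b * A * B + a * c * B ^ 2) ^ 7 with hn'def
  have hn' : ((n' * (A ^ 2 - b * A * B + a * c * B ^ 2) : ℤ) : ZMod 32) = 1 := pow_eight_eq_one_of_odd hNodd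
  have hχ : ZMod.χ₈ ((n' * A : ℤ) : ZMod 8) = 1 := chi8_eq_one_of_sq_mul h32 hu hl hodd hAdef hBdef hn'
  exact artinSymbol_principal_apply_sqrtX_eq_self h K ι hK a b c ha hD hprim h32 θ hθ hgen e he _ hγ hγm A B hAB n' hn' hχ y hy

end Summit.BirchSwinnertonDyer.PrintCf2.TheoremAOrderTwoLocal

end
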